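import Mathlib
import Summits.ValiantsHypothesis.ValiantsHypothesis.Theorems.KPlusLogSqLawStepTriple
import Summits.ValiantsHypothesis.ValiantsHypothesis.Theorems.KPlusLogSqLawStepFour

/-!
# The FOUR-STEP LAW — the order part at window level (static path model behind `KPlusLogSqLaw.TropicalB`)

Cell pub-symmetroid, seat conjb-2 (g22). A helper toward the crux `TropicalB`
(`Summit.ValiantsHypothesis.ValiantsHypothesis.Theses.KPlusLogSqLaw.TropicalB`, item
`stmt-ValiantsHypothesis-19771`); it earns no crux credit and is not evidence for `MatrixDescartes` or for
Valiant's hypothesis.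

SETTING (abstract upper class `up : ℕ → Prop`, as in `KPlusLogSqLawStepTriple` / `KPlusLogSqLawStepFour`): lines
`S_t(θ) = b t + s t * θ`; the window `[u, v]` is separated at `θ` iff every `up` line of `[u, v]` is strictly above
every non-`up` line of `[u, v]` at `θ`; `T[u, v]` is its separation set; row `j` (reach `d`) STEPS iff `T[j, j+d]` and
`T[j+1, j+d+1]` are non-empty and disjoint, and it MOVES RIGHT (LEFT) iff `T[j, j+d]` lies to the left (right) of
`T[j+1, j+d+1]`.

CONTENT — the ORDER PART of the FOUR-STEP LAW (THEORY-NOTE-g21 §3.1sexies; the affine cores of the two substantive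
cases are `KPlusLogSqLawStepFour.four_lrll_core` / `four_rrll_core`). For four rows `i, …, i+3` with `up (i+2)`,
`up (i+d+1)`, `¬ up (i+3)`, `¬ up (i+d+2)` (the parities of the even/odd model) and `d ≥ 2`:
* the four SIGN FACTS of row exactness: `c := S_{i+d+1} - S_{i+2}` is `< 0` on `T[i, i+d]` (this is
  `KPlusLogSqLawStepTriple.exact_row_gap`) and `> 0` on `T[i+3, i+d+3]` (`gap_left_up`); `c' := S_{i+3} - S_{i+d+2}` is
  `< 0` on `T[i+1, i+d+1]` (`gap_right_low`) and `> 0` on `T[i+4, i+d+4]` (`gap_left_low`) — each from the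
  disjointness of two consecutive separation sets;
* the WHOLE-INTERVAL ORDERS: if `c` is increasing (`s (i+2) < s (i+d+1)`) then `T[i, i+d] < T[i+3, i+d+3]`
  (`sep0_lt_sep3`); if `c'` is decreasing (`s (i+3) < s (i+d+2)`) then `T[i+4, i+d+4] < T[i+1, i+d+1]` (`sep4_lt_sep1`);
* consequently, if moreover row `i+3` moves right, then row `i` moves right (`first_right_of_orders`): the direction
  pattern `(L, ·, ·, R)` is impossible under the two monotonicities (`not_left_right_of_orders`).
In the four-step law the monotonicities are supplied by the TRIPLE LAW: in the middle pattern `(R, L)` (row `i+1` right,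
row `i+2` left) `KPlusLogSqLawStepTripleCases.triple_?r?` on rows `i, i+1, i+2` gives `s (i+2) < s (i+d+1)`, and the
same result applied to the configuration negated (`up ↦ ¬ up`, `S ↦ -S`) and reflected (`θ ↦ -θ`) on rows `i+1, i+2, i+3`
gives `s (i+3) < s (i+d+2)`; so this file settles the sub-patterns `(L,R,L,R)` (impossible) and `(R,R,L,R)` (the
reflection image of `(L,R,L,L)`), leaving `(L,R,L,L)` and `(R,R,L,L)` to the affine cores with the binding-pair
structure (`step_sup_structure`, `lookback_partner`, `step_inf_structure`) — the sequel that makes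
`KPlusLogSqLawStepLength.consecutive_steps_le_of_four` unconditional.
-/

set_option linter.dupNamespace false

namespace Summit.ValiantsHypothesis.ValiantsHypothesis.Theorems.KPlusLogSqLawStepFourOrder

open Summit.ValiantsHypothesis.ValiantsHypothesis.Theorems.KPlusLogSqLawStepTriple (exact_row_gap)
open Summit.ValiantsHypothesis.ValiantsHypothesis.Theorems.KPlusLogSqLawStepFour (incr_sign_sep decr_sign_sep)

/-- Exactness from disjointness: if `T[i, i+d]` and `T[i+1, i+d+1]` have no common point `θ`, the longer window
`[i, i+d+1]` is not separated at `θ`. -/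
theorem not_sep_succ (up : ℕ → Prop) (s b : ℕ → ℝ) (i d : ℕ) (θ : ℝ)
    (hdis : ¬ ((∀ e o : ℕ, i ≤ e → e ≤ i + d → i ≤ o → o ≤ i + d → up e → ¬ up o →
        b o + s o * θ < b e + s e * θ) ∧
      (∀ e o : ℕ, i + 1 ≤ e → e ≤ i + d + 1 → i + 1 ≤ o → o ≤ i + d + 1 → up e → ¬ up o →
        b o + s o * θ < b e + s e * θ))) :
    ¬ (∀ e o : ℕ, i ≤ e → e ≤ i + d + 1 → i ≤ o → o ≤ i + d + 1 → up e → ¬ up o →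
        b o + s o * θ < b e + s e * θ) := by
  intro h
  exact hdis ⟨fun e o h1 h2 h3 h4 he ho => h e o h1 (by omega) h3 (by omega) he ho,
    fun e o h1 h2 h3 h4 he ho => h e o (by omega) h2 (by omega) h4 he ho⟩

/-- Sign fact `c > 0` on `T[i+3, i+d+3]`: at a point of `T[i+3, i+d+3]` that is not in `T[i+2, i+d+2]`, the upper
line `i+2` lies strictly below the upper line `i+d+1`. -/
theorem gap_left_up (up : ℕ → Prop) (s b : ℕ → ℝ) (i d : ℕ) (θ : ℝ) (hd : 2 ≤ d) (hup2 : up (i + 2))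
    (hup1 : up (i + d + 1))
    (hy : (∀ e o : ℕ, i + 3 ≤ e → e ≤ i + d + 3 → i + 3 ≤ o → o ≤ i + d + 3 → up e → ¬ up o →
        b o + s o * θ < b e + s e * θ))
    (hdis : ¬ ((∀ e o : ℕ, i + 2 ≤ e → e ≤ i + d + 2 → i + 2 ≤ o → o ≤ i + d + 2 → up e → ¬ up o →
        b o + s o * θ < b e + s e * θ) ∧
      (∀ e o : ℕ, i + 3 ≤ e → e ≤ i + d + 3 → i + 3 ≤ o → o ≤ i + d + 3 → up e → ¬ up o →
        b o + s o * θ < b e + s e * θ))) :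
    b (i + 2) + s (i + 2) * θ < b (i + d + 1) + s (i + d + 1) * θ := by
  by_contra hge
  have hge' : b (i + d + 1) + s (i + d + 1) * θ ≤ b (i + 2) + s (i + 2) * θ := le_of_not_gt hge
  apply hdis
  refine ⟨?_, hy⟩
  intro e o h1 h2 h3 h4 he ho
  have ho3 : i + 3 ≤ o := by
    by_contra hoc
    have : o = i + 2 := by omega
    subst this
    exact ho hup2
  by_cases he3 : i + 3 ≤ e
  · exact hy e o he3 (by omega) ho3 (by omega) he ho
  · have : e = i + 2 := by omega
    subst this
    have h1o := hy (i + d + 1) o (by omega) (by omega) ho3 (by omega) hup1 ho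
    linarith

/-- Sign fact `c' < 0` on `T[i+1, i+d+1]`: at a point of `T[i+1, i+d+1]` that is not in `T[i+2, i+d+2]`, the lower
line `i+3` lies strictly below the lower line `i+d+2`. -/
theorem gap_right_low (up : ℕ → Prop) (s b : ℕ → ℝ) (i d : ℕ) (θ : ℝ) (hd : 2 ≤ d) (hlow3 : ¬ up (i + 3))
    (hlow2 : ¬ up (i + d + 2))
    (hx : (∀ e o : ℕ, i + 1 ≤ e → e ≤ i + d + 1 → i + 1 ≤ o → o ≤ i + d + 1 → up e → ¬ up o →
        b o + s o * θ < b e + s e * θ))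
    (hdis : ¬ ((∀ e o : ℕ, i + 1 ≤ e → e ≤ i + d + 1 → i + 1 ≤ o → o ≤ i + d + 1 → up e → ¬ up o →
        b o + s o * θ < b e + s e * θ) ∧
      (∀ e o : ℕ, i + 2 ≤ e → e ≤ i + d + 2 → i + 2 ≤ o → o ≤ i + d + 2 → up e → ¬ up o →
        b o + s o * θ < b e + s e * θ))) :
    b (i + 3) + s (i + 3) * θ < b (i + d + 2) + s (i + d + 2) * θ := by
  by_contra hge
  have hge' : b (i + d + 2) + s (i + d + 2) * θ ≤ b (i + 3) + s (i + 3) * θ := le_of_not_gt hge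
  apply hdis
  refine ⟨hx, ?_⟩
  intro e o h1 h2 h3 h4 he ho
  have he1 : e ≤ i + d + 1 := by
    by_contra hec
    have : e = i + d + 2 := by omega
    subst this
    exact hlow2 he
  by_cases ho1 : o ≤ i + d + 1
  · exact hx e o (by omega) he1 (by omega) ho1 he ho
  · have : o = i + d + 2 := by omega
    subst this
    have he3 := hx e (i + 3) (by omega) he1 (by omega) (by omega) he hlow3
    linarith

/-- Sign fact `c' > 0` on `T[i+4, i+d+4]`: at a point of `T[i+4, i+d+4]` that is not in `T[i+3, i+d+3]`, the lower
line `i+d+2` lies strictly below the lower line `i+3`. -/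
theorem gap_left_low (up : ℕ → Prop) (s b : ℕ → ℝ) (i d : ℕ) (θ : ℝ) (hd : 2 ≤ d) (hlow3 : ¬ up (i + 3))
    (hlow2 : ¬ up (i + d + 2))
    (hy : (∀ e o : ℕ, i + 4 ≤ e → e ≤ i + d + 4 → i + 4 ≤ o → o ≤ i + d + 4 → up e → ¬ up o →
        b o + s o * θ < b e + s e * θ))
    (hdis : ¬ ((∀ e o : ℕ, i + 3 ≤ e → e ≤ i + d + 3 → i + 3 ≤ o → o ≤ i + d + 3 → up e → ¬ up o →
        b o + s o * θ < b e + s e * θ) ∧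
      (∀ e o : ℕ, i + 4 ≤ e → e ≤ i + d + 4 → i + 4 ≤ o → o ≤ i + d + 4 → up e → ¬ up o →
        b o + s o * θ < b e + s e * θ))) :
    b (i + d + 2) + s (i + d + 2) * θ < b (i + 3) + s (i + 3) * θ := by
  by_contra hge
  have hge' : b (i + 3) + s (i + 3) * θ ≤ b (i + d + 2) + s (i + d + 2) * θ := le_of_not_gt hge
  apply hdis
  refine ⟨?_, hy⟩
  intro e o h1 h2 h3 h4 he ho
  have he4 : i + 4 ≤ e := by
    by_contra hec
    have : e = i + 3 := by omega
    subst this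
    exact hlow3 he
  by_cases ho4 : i + 4 ≤ o
  · exact hy e o he4 (by omega) ho4 (by omega) he ho
  · have : o = i + 3 := by omega
    subst this
    have he2 := hy e (i + d + 2) he4 (by omega) (by omega) (by omega) he hlow2
    linarith

/-- WHOLE-INTERVAL ORDER `T[i, i+d] < T[i+3, i+d+3]` when `c = S_{i+d+1} - S_{i+2}` is increasing and rows `i`, `i+2`
are exact (consecutive separation sets disjoint). -/
theorem sep0_lt_sep3 (up : ℕ → Prop) (s b : ℕ → ℝ) (i d : ℕ) (hd : 2 ≤ d) (hup2 : up (i + 2))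
    (hup1 : up (i + d + 1)) (hmono : s (i + 2) < s (i + d + 1))
    (hdis0 : ∀ θ : ℝ, ¬ ((∀ e o : ℕ, i ≤ e → e ≤ i + d → i ≤ o → o ≤ i + d → up e → ¬ up o →
        b o + s o * θ < b e + s e * θ) ∧
      (∀ e o : ℕ, i + 1 ≤ e → e ≤ i + d + 1 → i + 1 ≤ o → o ≤ i + d + 1 → up e → ¬ up o →
        b o + s o * θ < b e + s e * θ)))
    (hdis2 : ∀ θ : ℝ, ¬ ((∀ e o : ℕ, i + 2 ≤ e → e ≤ i + d + 2 → i + 2 ≤ o → o ≤ i + d + 2 → up e → ¬ up o →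
        b o + s o * θ < b e + s e * θ) ∧
      (∀ e o : ℕ, i + 3 ≤ e → e ≤ i + d + 3 → i + 3 ≤ o → o ≤ i + d + 3 → up e → ¬ up o →
        b o + s o * θ < b e + s e * θ)))
    (x y : ℝ) (hx : (∀ e o : ℕ, i ≤ e → e ≤ i + d → i ≤ o → o ≤ i + d → up e → ¬ up o →
        b o + s o * x < b e + s e * x))
    (hy : (∀ e o : ℕ, i + 3 ≤ e → e ≤ i + d + 3 → i + 3 ≤ o → o ≤ i + d + 3 → up e → ¬ up o →
        b o + s o * y < b e + s e * y)) : x < y := by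
  have hcx : b (i + d + 1) + s (i + d + 1) * x < b (i + 2) + s (i + 2) * x :=
    exact_row_gap up s b i d x hd hup2 hup1 hx (not_sep_succ up s b i d x (hdis0 x))
  have hcy : b (i + 2) + s (i + 2) * y < b (i + d + 1) + s (i + d + 1) * y :=
    gap_left_up up s b i d y hd hup2 hup1 hy (hdis2 y)
  exact incr_sign_sep (s (i + 2)) (b (i + 2)) (s (i + d + 1)) (b (i + d + 1)) x y hmono hcx hcy

/-- WHOLE-INTERVAL ORDER `T[i+4, i+d+4] < T[i+1, i+d+1]` when `c' = S_{i+3} - S_{i+d+2}` is decreasing and rows `i+1`,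
`i+3` are exact. -/
theorem sep4_lt_sep1 (up : ℕ → Prop) (s b : ℕ → ℝ) (i d : ℕ) (hd : 2 ≤ d) (hlow3 : ¬ up (i + 3))
    (hlow2 : ¬ up (i + d + 2)) (hmono' : s (i + 3) < s (i + d + 2))
    (hdis1 : ∀ θ : ℝ, ¬ ((∀ e o : ℕ, i + 1 ≤ e → e ≤ i + d + 1 → i + 1 ≤ o → o ≤ i + d + 1 → up e → ¬ up o →
        b o + s o * θ < b e + s e * θ) ∧
      (∀ e o : ℕ, i + 2 ≤ e → e ≤ i + d + 2 → i + 2 ≤ o → o ≤ i + d + 2 → up e → ¬ up o →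
        b o + s o * θ < b e + s e * θ)))
    (hdis3 : ∀ θ : ℝ, ¬ ((∀ e o : ℕ, i + 3 ≤ e → e ≤ i + d + 3 → i + 3 ≤ o → o ≤ i + d + 3 → up e → ¬ up o →
        b o + s o * θ < b e + s e * θ) ∧
      (∀ e o : ℕ, i + 4 ≤ e → e ≤ i + d + 4 → i + 4 ≤ o → o ≤ i + d + 4 → up e → ¬ up o →
        b o + s o * θ < b e + s e * θ)))
    (x y : ℝ) (hx : (∀ e o : ℕ, i + 4 ≤ e → e ≤ i + d + 4 → i + 4 ≤ o → o ≤ i + d + 4 → up e → ¬ up o →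
        b o + s o * x < b e + s e * x))
    (hy : (∀ e o : ℕ, i + 1 ≤ e → e ≤ i + d + 1 → i + 1 ≤ o → o ≤ i + d + 1 → up e → ¬ up o →
        b o + s o * y < b e + s e * y)) : x < y := by
  have hcx : b (i + d + 2) + s (i + d + 2) * x < b (i + 3) + s (i + 3) * x :=
    gap_left_low up s b i d x hd hlow3 hlow2 hx (hdis3 x)
  have hcy : b (i + 3) + s (i + 3) * y < b (i + d + 2) + s (i + d + 2) * y :=
    gap_right_low up s b i d y hd hlow3 hlow2 hy (hdis1 y)
  exact decr_sign_sep (s (i + d + 2)) (b (i + d + 2)) (s (i + 3)) (b (i + 3)) x y hmono' hcx hcy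

/-- ORDER COROLLARY of the four-step law: under the two monotonicities (`c` increasing, `c'` decreasing), if rows
`i, …, i+3` are exact, `T[i+3, i+d+3]`, `T[i+4, i+d+4]` are non-empty and row `i+3` moves right, then row `i` moves
right: `T[i, i+d] < T[i+3, i+d+3] < T[i+4, i+d+4] < T[i+1, i+d+1]`. -/
theorem first_right_of_orders (up : ℕ → Prop) (s b : ℕ → ℝ) (i d : ℕ) (hd : 2 ≤ d) (hup2 : up (i + 2))
    (hup1 : up (i + d + 1)) (hlow3 : ¬ up (i + 3)) (hlow2 : ¬ up (i + d + 2))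
    (hmono : s (i + 2) < s (i + d + 1)) (hmono' : s (i + 3) < s (i + d + 2))
    (hdis0 : ∀ θ : ℝ, ¬ ((∀ e o : ℕ, i ≤ e → e ≤ i + d → i ≤ o → o ≤ i + d → up e → ¬ up o →
        b o + s o * θ < b e + s e * θ) ∧
      (∀ e o : ℕ, i + 1 ≤ e → e ≤ i + d + 1 → i + 1 ≤ o → o ≤ i + d + 1 → up e → ¬ up o →
        b o + s o * θ < b e + s e * θ)))
    (hdis1 : ∀ θ : ℝ, ¬ ((∀ e o : ℕ, i + 1 ≤ e → e ≤ i + d + 1 → i + 1 ≤ o → o ≤ i + d + 1 → up e → ¬ up o →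
        b o + s o * θ < b e + s e * θ) ∧
      (∀ e o : ℕ, i + 2 ≤ e → e ≤ i + d + 2 → i + 2 ≤ o → o ≤ i + d + 2 → up e → ¬ up o →
        b o + s o * θ < b e + s e * θ)))
    (hdis2 : ∀ θ : ℝ, ¬ ((∀ e o : ℕ, i + 2 ≤ e → e ≤ i + d + 2 → i + 2 ≤ o → o ≤ i + d + 2 → up e → ¬ up o →
        b o + s o * θ < b e + s e * θ) ∧
      (∀ e o : ℕ, i + 3 ≤ e → e ≤ i + d + 3 → i + 3 ≤ o → o ≤ i + d + 3 → up e → ¬ up o →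
        b o + s o * θ < b e + s e * θ)))
    (hdis3 : ∀ θ : ℝ, ¬ ((∀ e o : ℕ, i + 3 ≤ e → e ≤ i + d + 3 → i + 3 ≤ o → o ≤ i + d + 3 → up e → ¬ up o →
        b o + s o * θ < b e + s e * θ) ∧
      (∀ e o : ℕ, i + 4 ≤ e → e ≤ i + d + 4 → i + 4 ≤ o → o ≤ i + d + 4 → up e → ¬ up o →
        b o + s o * θ < b e + s e * θ)))
    (hA3 : ∃ θ : ℝ, (∀ e o : ℕ, i + 3 ≤ e → e ≤ i + d + 3 → i + 3 ≤ o → o ≤ i + d + 3 → up e → ¬ up o →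
        b o + s o * θ < b e + s e * θ))
    (hA4 : ∃ θ : ℝ, (∀ e o : ℕ, i + 4 ≤ e → e ≤ i + d + 4 → i + 4 ≤ o → o ≤ i + d + 4 → up e → ¬ up o →
        b o + s o * θ < b e + s e * θ))
    (hR3 : ∀ θ θ' : ℝ, (∀ e o : ℕ, i + 3 ≤ e → e ≤ i + d + 3 → i + 3 ≤ o → o ≤ i + d + 3 → up e → ¬ up o →
        b o + s o * θ < b e + s e * θ) →
      (∀ e o : ℕ, i + 4 ≤ e → e ≤ i + d + 4 → i + 4 ≤ o → o ≤ i + d + 4 → up e → ¬ up o →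
        b o + s o * θ' < b e + s e * θ') → θ < θ') :
    ∀ x y : ℝ, (∀ e o : ℕ, i ≤ e → e ≤ i + d → i ≤ o → o ≤ i + d → up e → ¬ up o →
        b o + s o * x < b e + s e * x) →
      (∀ e o : ℕ, i + 1 ≤ e → e ≤ i + d + 1 → i + 1 ≤ o → o ≤ i + d + 1 → up e → ¬ up o →
        b o + s o * y < b e + s e * y) → x < y := by
  intro x y hx hy
  obtain ⟨t₃, ht₃⟩ := hA3
  obtain ⟨t₄, ht₄⟩ := hA4
  have h1 : x < t₃ := sep0_lt_sep3 up s b i d hd hup2 hup1 hmono hdis0 hdis2 x t₃ hx ht₃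
  have h2 : t₃ < t₄ := hR3 t₃ t₄ ht₃ ht₄
  have h3 : t₄ < y := sep4_lt_sep1 up s b i d hd hlow3 hlow2 hmono' hdis1 hdis3 t₄ y ht₄ hy
  linarith

/-- The direction pattern `(L, ·, ·, R)` on rows `i, …, i+3` is impossible under the two monotonicities: in the
four-step law this excludes the middle zigzag `(L, R, L, R)` outright. -/
theorem not_left_right_of_orders (up : ℕ → Prop) (s b : ℕ → ℝ) (i d : ℕ) (hd : 2 ≤ d) (hup2 : up (i + 2))
    (hup1 : up (i + d + 1)) (hlow3 : ¬ up (i + 3)) (hlow2 : ¬ up (i + d + 2))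
    (hmono : s (i + 2) < s (i + d + 1)) (hmono' : s (i + 3) < s (i + d + 2))
    (hdis0 : ∀ θ : ℝ, ¬ ((∀ e o : ℕ, i ≤ e → e ≤ i + d → i ≤ o → o ≤ i + d → up e → ¬ up o →
        b o + s o * θ < b e + s e * θ) ∧
      (∀ e o : ℕ, i + 1 ≤ e → e ≤ i + d + 1 → i + 1 ≤ o → o ≤ i + d + 1 → up e → ¬ up o →
        b o + s o * θ < b e + s e * θ)))
    (hdis1 : ∀ θ : ℝ, ¬ ((∀ e o : ℕ, i + 1 ≤ e → e ≤ i + d + 1 → i + 1 ≤ o → o ≤ i + d + 1 → up e → ¬ up o →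
        b o + s o * θ < b e + s e * θ) ∧
      (∀ e o : ℕ, i + 2 ≤ e → e ≤ i + d + 2 → i + 2 ≤ o → o ≤ i + d + 2 → up e → ¬ up o →
        b o + s o * θ < b e + s e * θ)))
    (hdis2 : ∀ θ : ℝ, ¬ ((∀ e o : ℕ, i + 2 ≤ e → e ≤ i + d + 2 → i + 2 ≤ o → o ≤ i + d + 2 → up e → ¬ up o →
        b o + s o * θ < b e + s e * θ) ∧
      (∀ e o : ℕ, i + 3 ≤ e → e ≤ i + d + 3 → i + 3 ≤ o → o ≤ i + d + 3 → up e → ¬ up o →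
        b o + s o * θ < b e + s e * θ)))
    (hdis3 : ∀ θ : ℝ, ¬ ((∀ e o : ℕ, i + 3 ≤ e → e ≤ i + d + 3 → i + 3 ≤ o → o ≤ i + d + 3 → up e → ¬ up o →
        b o + s o * θ < b e + s e * θ) ∧
      (∀ e o : ℕ, i + 4 ≤ e → e ≤ i + d + 4 → i + 4 ≤ o → o ≤ i + d + 4 → up e → ¬ up o →
        b o + s o * θ < b e + s e * θ)))
    (hA0 : ∃ θ : ℝ, (∀ e o : ℕ, i ≤ e → e ≤ i + d → i ≤ o → o ≤ i + d → up e → ¬ up o →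
        b o + s o * θ < b e + s e * θ))
    (hA1 : ∃ θ : ℝ, (∀ e o : ℕ, i + 1 ≤ e → e ≤ i + d + 1 → i + 1 ≤ o → o ≤ i + d + 1 → up e → ¬ up o →
        b o + s o * θ < b e + s e * θ))
    (hA3 : ∃ θ : ℝ, (∀ e o : ℕ, i + 3 ≤ e → e ≤ i + d + 3 → i + 3 ≤ o → o ≤ i + d + 3 → up e → ¬ up o →
        b o + s o * θ < b e + s e * θ))
    (hA4 : ∃ θ : ℝ, (∀ e o : ℕ, i + 4 ≤ e → e ≤ i + d + 4 → i + 4 ≤ o → o ≤ i + d + 4 → up e → ¬ up o →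
        b o + s o * θ < b e + s e * θ))
    (hL0 : ∀ θ θ' : ℝ, (∀ e o : ℕ, i ≤ e → e ≤ i + d → i ≤ o → o ≤ i + d → up e → ¬ up o →
        b o + s o * θ < b e + s e * θ) →
      (∀ e o : ℕ, i + 1 ≤ e → e ≤ i + d + 1 → i + 1 ≤ o → o ≤ i + d + 1 → up e → ¬ up o →
        b o + s o * θ' < b e + s e * θ') → θ' < θ)
    (hR3 : ∀ θ θ' : ℝ, (∀ e o : ℕ, i + 3 ≤ e → e ≤ i + d + 3 → i + 3 ≤ o → o ≤ i + d + 3 → up e → ¬ up o →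
        b o + s o * θ < b e + s e * θ) →
      (∀ e o : ℕ, i + 4 ≤ e → e ≤ i + d + 4 → i + 4 ≤ o → o ≤ i + d + 4 → up e → ¬ up o →
        b o + s o * θ' < b e + s e * θ') → θ < θ') : False := by
  obtain ⟨x, hx⟩ := hA0
  obtain ⟨y, hy⟩ := hA1
  have h1 : x < y :=
    first_right_of_orders up s b i d hd hup2 hup1 hlow3 hlow2 hmono hmono' hdis0 hdis1 hdis2 hdis3 hA3 hA4 hR3 x y hx hy
  have h2 : y < x := hL0 x y hx hy
  exact lt_asymm h1 h2

end Summit.ValiantsHypothesis.ValiantsHypothesis.Theorems.KPlusLogSqLawStepFourOrder
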